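/- Copyright: the b2b-balaban cell (near-miss cell 7), T⁴-continuum fan-out, lineage t4-ne7b-p1 (node U5c COUNT
member).  Released under the licence of the surrounding project. -/
import Summits.QuantumFields.BalabanUV.T4Continuum.Support.HistoryGenealogyPedigreeOrder

/-!
# DISSOLVING THE FRESH CLUSTERS (junction M4, pass V, part 1a — the bookkeeping: definitions): a component made of several NEW
regions and no old line is removed from its level and replaced by one single-birth pseudo-component per region, and
wherever it is continued its entry is SPLICED into those regions — so it enters every descendant's pedigree as a join
ONE LEVEL LATE of births at its own level; `WF` is PROVED for the dissolved bookkeeping and **`NoFreshClusters` HOLDS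
OF IT BY CONSTRUCTION** (owner module of row NE7b, lineage `t4-ne7b-p1` gen 42; ruling R-OWNER-42-1 «pass V supersedes
pass T» = this lineage's R-OWNER-22-7 (α) «an all-new join is dated one step late, by encoding» applied AT THE
JUNCTION; re-open object (α), `SCOPE-alpha.md` v2.3 §5 row M4, located open point G-M4-1 — PRE-POSITIONING ONLY)

Summits-side support leaf of the T⁴-continuum cell (rung (B)+1 on a FINITE torus only; NOT infinite volume, NOT the
mass gap, NOT the Clay statement; NOT a proof of the spine estimate NE7b, which is the cell's OWN estimate, NOT PRINTED
and NOT PROVED).  [folklore] finite list ∕ finset combinatorics over row S13's `ComponentHistory` (`comp`, `newReg`,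
`cls`, `constit`, `parts`∕`news`, `lefts`∕`rights`, `WF`) and brick 2c's displayed condition
`HistoryGenealogyPedigree.NoFreshClusters`; PROCESS-AGNOSTIC (no geometry, no flow, no readiness); nothing printed is
asserted, no `def … : Prop` fact of Bałaban's, no cite-tagged hypothesis, zero `sorry`.  B16 = [Balaban1989LargeFieldII]
pp. 385–386 is a manuscript UNDER AUDIT; locators only.

WHY.  The junction `HistoryGenealogyJunction.junction_pedM` (p251528) delivers the END's seven `RealisedDomainsW`
fields for print's process under the DISPLAYED condition `NoFreshClusters histM` — false in general for print's
process: B16 p. 385 «Take a component Z of the region Z₁. It is determined by some of the large field regions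
Z₁^{(i)} … Z ⊂ ⋃_i (Z₁^{(i)})^{~2}» — a FRESH CLUSTER (several new regions touching, no old line) is booked by
(1.84)–(1.85) p. 386 as the births of its regions with all reserves but one pooled, i.e. as a MERGER OF BIRTHS at the
formation level.  The END's dictionary dates a merger strictly after its head's birth (`T4CanonicalMenus.Chrono`,
`Pedigree.HeadOldest` clause 2), and the lineage's ruling R-OWNER-22-7 (α) books an all-new join ONE STEP LATE.  THIS
FILE does (α) on the bookkeeping: **`ComponentHistory.dissolve`**.  For `H : ComponentHistory γ` and a splice order
`spl : ℕ → γ → γ → List γ` (level of the part, the continuing component, the fresh part ↦ an enumeration of the fresh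
part's new regions; a permutation — `SpliceOK`; the geometric choice is part 2's):
* `H.Fresh j c` — `c ∈ comp j`, no old part, at least two constituents; `H.pseudo j` — the new regions of the fresh
  clusters of level `j` (the pseudo-components; a pseudo-component's label IS its region, so a domain map reading the
  label's region reads it uniformly);
* `(H.dissolve spl).comp j = (comp j ∖ fresh) ∪ pseudo j`; `constit` of a pseudo-component `n` is `[inr n]`; `constit`
  of a real non-fresh component of level `j + 1` is `H.constit` with every entry `inl p`, `p` fresh at `j`, replaced by
  `(spl j c p).map inl` (`splice`); level `0` and `newReg`∕`cls` unchanged;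
* PROVED here: the parts∕news bookkeeping of the dissolved history (`parts_dissolve_succ`, `news_dissolve_real`,
  `mem_parts_dissolve_succ_iff`, …).  Part 1b (`…DissolveWF`): the side conditions `SpliceOK`∕`LabelOK`,
  **`wf_dissolve`** and **`noFreshClusters_dissolve`**.
Part 2 (`…DissolveClauses`) transports `LevelClausesW` (with the lastStep∕edom dichotomy of the «V-lines»); part 3
(`…JunctionV`) re-runs the junction on `histM.dissolve` with `NoFreshClusters` DISCHARGED.

HONEST.  Proves nothing of Bałaban's; a re-indexing of OUR bookkeeping; by-name class of every `WALL-NE7b-P1.md` §2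
binder UNCHANGED; NE7b NOT proved; spine 0∕9.  HONEST DEPENDENCY (cell): continuum YM on T⁴ ⇐ BetaPertH ∧ nine spine
estimates (0/9 proved); BetaPertH ⇐ (D1) ∧ (D4) ∧ CAP+tail; G-an2-4 gates asym, D1 and NE2/3/4.  This file changes none
of it. -/

open Finset
open Literature.MathematicalPhysics.QuantumFieldTheory.Balaban1983to89
open Summit.QuantumFields.BalabanUV.T4Continuum.HistoryGenealogyExtraction
open Summit.QuantumFields.BalabanUV.T4Continuum.HistoryGenealogyRealise (Lab)

namespace Summit.QuantumFields.BalabanUV.T4Continuum.HistoryGenealogyExtraction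

/-! ## §1 List lemmas: projections of appended ∕ mapped lists, the splice of a constituent list -/

section SumLists

variable {α β : Type*}

/-- `lefts` of an appended list [folklore] -/
theorem lefts_append : ∀ l₁ l₂ : List (α ⊕ β), lefts (l₁ ++ l₂) = lefts l₁ ++ lefts l₂
  | [], _ => rfl
  | Sum.inl a :: l₁, l₂ => by rw [List.cons_append, lefts_cons_inl, lefts_cons_inl, lefts_append l₁ l₂]; rfl
  | Sum.inr b :: l₁, l₂ => by rw [List.cons_append, lefts_cons_inr, lefts_cons_inr, lefts_append l₁ l₂]

/-- `rights` of an appended list [folklore] -/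
theorem rights_append : ∀ l₁ l₂ : List (α ⊕ β), rights (l₁ ++ l₂) = rights l₁ ++ rights l₂
  | [], _ => rfl
  | Sum.inl a :: l₁, l₂ => by rw [List.cons_append, rights_cons_inl, rights_cons_inl, rights_append l₁ l₂]
  | Sum.inr b :: l₁, l₂ => by rw [List.cons_append, rights_cons_inr, rights_cons_inr, rights_append l₁ l₂]; rfl

/-- `lefts` of a list of left entries is the list [folklore] -/
@[simp] theorem lefts_map_inl : ∀ l : List α, lefts (l.map (Sum.inl : α → α ⊕ β)) = l
  | [] => rfl
  | a :: l => by rw [List.map_cons, lefts_cons_inl, lefts_map_inl l]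

/-- `rights` of a list of left entries is empty [folklore] -/
@[simp] theorem rights_map_inl : ∀ l : List α, rights (l.map (Sum.inl : α → α ⊕ β)) = []
  | [] => rfl
  | a :: l => by rw [List.map_cons, rights_cons_inl, rights_map_inl l]

/-- a list with no left entry is the list of its right entries [folklore] -/
theorem eq_map_inr_rights_of_lefts_eq_nil : ∀ {l : List (α ⊕ β)}, lefts l = [] → l = (rights l).map Sum.inr
  | [], _ => rfl
  | Sum.inl a :: l, h => by simp at h
  | Sum.inr b :: l, h => by
      rw [lefts_cons_inr] at h
      rw [rights_cons_inr, List.map_cons, ← eq_map_inr_rights_of_lefts_eq_nil h]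

/-- **THE SPLICE** of a constituent list along a part-replacement map `pV` (an old part `p` ↦ the list `pV p` of old
parts standing in for it; new regions untouched). [folklore] -/
def splice (pV : α → List α) : List (α ⊕ β) → List (α ⊕ β)
  | [] => []
  | Sum.inl p :: l => (pV p).map Sum.inl ++ splice pV l
  | Sum.inr n :: l => Sum.inr n :: splice pV l

/-- splice of the empty list [folklore] -/
@[simp] theorem splice_nil (pV : α → List α) : splice pV ([] : List (α ⊕ β)) = [] := rfl

/-- splice past an old part [folklore] -/
@[simp] theorem splice_cons_inl (pV : α → List α) (p : α) (l : List (α ⊕ β)) :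
    splice pV (Sum.inl p :: l) = (pV p).map Sum.inl ++ splice pV l := rfl

/-- splice past a new region [folklore] -/
@[simp] theorem splice_cons_inr (pV : α → List α) (n : β) (l : List (α ⊕ β)) :
    splice pV (Sum.inr n :: l) = Sum.inr n :: splice pV l := rfl

/-- the new regions of a spliced list are those of the list [folklore] -/
theorem rights_splice (pV : α → List α) : ∀ l : List (α ⊕ β), rights (splice pV l) = rights l
  | [] => rfl
  | Sum.inl p :: l => by rw [splice_cons_inl, rights_append, rights_map_inl, rights_cons_inl, rights_splice pV l]; rfl
  | Sum.inr n :: l => by rw [splice_cons_inr, rights_cons_inr, rights_cons_inr, rights_splice pV l]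

/-- the old parts of a spliced list are the replacements of the old parts, in order [folklore] -/
theorem lefts_splice (pV : α → List α) : ∀ l : List (α ⊕ β), lefts (splice pV l) = (lefts l).flatMap pV
  | [] => rfl
  | Sum.inl p :: l => by
      rw [splice_cons_inl, lefts_append, lefts_map_inl, lefts_cons_inl, lefts_splice pV l, List.flatMap_cons]
  | Sum.inr n :: l => by rw [splice_cons_inr, lefts_cons_inr, lefts_cons_inr, lefts_splice pV l]

/-- a splice with nonempty replacements does not shorten the list [folklore] -/
theorem length_le_length_splice {pV : α → List α} (h : ∀ p, pV p ≠ []) :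
    ∀ l : List (α ⊕ β), l.length ≤ (splice pV l).length
  | [] => le_rfl
  | Sum.inl p :: l => by
      rw [splice_cons_inl, List.length_append, List.length_map, List.length_cons]
      have h1 : 1 ≤ (pV p).length := List.length_pos_iff.2 (h p)
      have ih := length_le_length_splice h l
      omega
  | Sum.inr n :: l => by
      rw [splice_cons_inr, List.length_cons, List.length_cons]
      exact Nat.succ_le_succ (length_le_length_splice h l)

/-- the splice of a list with no old part is the list [folklore] -/
theorem splice_eq_self_of_lefts_eq_nil (pV : α → List α) {l : List (α ⊕ β)} (h : lefts l = []) : splice pV l = l := by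
  rw [eq_map_inr_rights_of_lefts_eq_nil h]
  generalize rights l = r
  induction r with
  | nil => rfl
  | cons b r ih => rw [List.map_cons, splice_cons_inr, ih]

/-- the splice of a lone old part [folklore] -/
theorem splice_singleton_inl (pV : α → List α) (p : α) :
    splice pV ([Sum.inl p] : List (α ⊕ β)) = (pV p).map Sum.inl := by
  rw [splice_cons_inl, splice_nil, List.append_nil]

/-- the splice of a lone new region [folklore] -/
theorem splice_singleton_inr (pV : α → List α) (n : β) : splice pV ([Sum.inr n] : List (α ⊕ β)) = [Sum.inr n] := rfl

/-- membership in a splice: a replacement of a listed old part, or a listed new region [folklore] -/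
theorem mem_splice_iff (pV : α → List α) (x : α ⊕ β) :
    ∀ l : List (α ⊕ β), x ∈ splice pV l ↔ (∃ p, Sum.inl p ∈ l ∧ ∃ q ∈ pV p, x = Sum.inl q) ∨ (∃ n, x = Sum.inr n ∧ Sum.inr n ∈ l)
  | [] => by simp
  | Sum.inl p :: l => by
      rw [splice_cons_inl, List.mem_append, List.mem_map, mem_splice_iff pV x l]
      constructor
      · rintro (⟨q, hq, rfl⟩ | ⟨p', hp', q, hq, rfl⟩ | ⟨n, rfl, hn⟩)
        · exact Or.inl ⟨p, List.mem_cons_self, q, hq, rfl⟩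
        · exact Or.inl ⟨p', List.mem_cons_of_mem _ hp', q, hq, rfl⟩
        · exact Or.inr ⟨n, rfl, List.mem_cons_of_mem _ hn⟩
      · rintro (⟨p', hp', q, hq, rfl⟩ | ⟨n, rfl, hn⟩)
        · rcases List.mem_cons.1 hp' with h | h
          · rw [Sum.inl.inj h] at hq; exact Or.inl ⟨q, hq, rfl⟩
          · exact Or.inr (Or.inl ⟨p', h, q, hq, rfl⟩)
        · rcases List.mem_cons.1 hn with h | h
          · exact absurd h (by simp)
          · exact Or.inr (Or.inr ⟨n, rfl, h⟩)
  | Sum.inr m :: l => by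
      rw [splice_cons_inr, List.mem_cons, mem_splice_iff pV x l]
      constructor
      · rintro (rfl | ⟨p', hp', q, hq, rfl⟩ | ⟨n, rfl, hn⟩)
        · exact Or.inr ⟨m, rfl, List.mem_cons_self⟩
        · exact Or.inl ⟨p', List.mem_cons_of_mem _ hp', q, hq, rfl⟩
        · exact Or.inr ⟨n, rfl, List.mem_cons_of_mem _ hn⟩
      · rintro (⟨p', hp', q, hq, rfl⟩ | ⟨n, rfl, hn⟩)
        · rcases List.mem_cons.1 hp' with h | h
          · exact absurd h (by simp)
          · exact Or.inr (Or.inl ⟨p', h, q, hq, rfl⟩)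
        · rcases List.mem_cons.1 hn with h | h
          · exact Or.inl h
          · exact Or.inr (Or.inr ⟨n, rfl, h⟩)

end SumLists

/-! ## §2 Fresh clusters, pseudo-components, the dissolved bookkeeping -/

namespace ComponentHistory

noncomputable section

open Classical

variable {γ : Type*} (H : ComponentHistory γ)

/-- **A FRESH CLUSTER** of level `j`: a component with NO old part and AT LEAST TWO constituents — several new regions
of step `j` touching, no old line (B16 p. 385 «Z ⊂ ⋃_i (Z₁^{(i)})^{~2}», locator). [folklore] -/
def Fresh (j : ℕ) (c : γ) : Prop := c ∈ H.comp j ∧ H.parts j c = [] ∧ 2 ≤ (H.constit j c).length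

variable {H} in
/-- a fresh cluster is a component [folklore] -/
theorem Fresh.mem {j : ℕ} {c : γ} (h : H.Fresh j c) : c ∈ H.comp j := h.1

variable {H} in
/-- a fresh cluster has no old part [folklore] -/
theorem Fresh.parts_eq {j : ℕ} {c : γ} (h : H.Fresh j c) : H.parts j c = [] := h.2.1

variable {H} in
/-- a fresh cluster has at least two constituents [folklore] -/
theorem Fresh.two_le {j : ℕ} {c : γ} (h : H.Fresh j c) : 2 ≤ (H.constit j c).length := h.2.2

variable {H} in
/-- the constituents of a fresh cluster are its new regions [folklore] -/
theorem Fresh.constit_eq {j : ℕ} {c : γ} (h : H.Fresh j c) : H.constit j c = (H.news j c).map Sum.inr :=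
  eq_map_inr_rights_of_lefts_eq_nil h.parts_eq

variable {H} in
/-- a fresh cluster has at least two new regions [folklore] -/
theorem Fresh.two_le_news {j : ℕ} {c : γ} (h : H.Fresh j c) : 2 ≤ (H.news j c).length := by
  have := h.two_le; rw [h.constit_eq, List.length_map] at this; exact this

variable {H} in
/-- a fresh cluster has a new region [folklore] -/
theorem Fresh.news_ne_nil {j : ℕ} {c : γ} (h : H.Fresh j c) : H.news j c ≠ [] := by
  intro he; have := h.two_le_news; rw [he] at this; simp at this

variable {H} in
/-- a component with an old part is not fresh [folklore] -/
theorem not_fresh_of_parts_ne_nil {j : ℕ} {c : γ} (h : H.parts j c ≠ []) : ¬ H.Fresh j c := fun hf => h hf.parts_eq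

variable {H} in
/-- a component with at most one constituent is not fresh [folklore] -/
theorem not_fresh_of_length_le_one {j : ℕ} {c : γ} (h : (H.constit j c).length ≤ 1) : ¬ H.Fresh j c :=
  fun hf => by have := hf.two_le; omega

variable [DecidableEq γ]

/-- **THE PSEUDO-COMPONENTS** of level `j`: the new regions of the fresh clusters of level `j` (each will stand for
itself as a single-birth component). [folklore] -/
def pseudo (j : ℕ) : Finset γ :=
  ((H.comp j).filter fun c => H.Fresh j c).biUnion fun c => (H.news j c).toFinset

/-- membership in the pseudo-components [folklore] -/
theorem mem_pseudo_iff {j : ℕ} {n : γ} : n ∈ H.pseudo j ↔ ∃ c, H.Fresh j c ∧ n ∈ H.news j c := by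
  classical
  simp only [pseudo, Finset.mem_biUnion, Finset.mem_filter, List.mem_toFinset]
  constructor
  · rintro ⟨c, ⟨-, hf⟩, hn⟩; exact ⟨c, hf, hn⟩
  · rintro ⟨c, hf, hn⟩; exact ⟨c, ⟨hf.mem, hf⟩, hn⟩

/-- **THE PART REPLACEMENT** at part-level `j` inside the continuing component `x`: a fresh part is replaced by the
chosen enumeration of its new regions, any other part stands. [folklore] -/
def partV (spl : ℕ → γ → γ → List γ) (j : ℕ) (x : γ) (p : γ) : List γ :=
  if H.Fresh j p then spl j x p else [p]

omit [DecidableEq γ] in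
/-- replacement of a fresh part [folklore] -/
theorem partV_of_fresh (spl : ℕ → γ → γ → List γ) {j : ℕ} (x : γ) {p : γ} (h : H.Fresh j p) :
    H.partV spl j x p = spl j x p := by
  classical
  exact if_pos h

omit [DecidableEq γ] in
/-- replacement of a non-fresh part [folklore] -/
theorem partV_of_not_fresh (spl : ℕ → γ → γ → List γ) {j : ℕ} (x : γ) {p : γ} (h : ¬ H.Fresh j p) :
    H.partV spl j x p = [p] := by
  classical
  exact if_neg h

/-- **THE DISSOLVED CONSTITUENT LISTS**: a pseudo-component is the lone birth of its region; a real non-fresh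
component keeps its list at level `0` and has it spliced at a successor level; anything else has none. [folklore] -/
def constitV (spl : ℕ → γ → γ → List γ) : ℕ → γ → List (γ ⊕ γ)
  | 0, x => if x ∈ H.pseudo 0 then [Sum.inr x] else if x ∈ H.comp 0 ∧ ¬ H.Fresh 0 x then H.constit 0 x else []
  | j + 1, x =>
      if x ∈ H.pseudo (j + 1) then [Sum.inr x]
      else if x ∈ H.comp (j + 1) ∧ ¬ H.Fresh (j + 1) x then splice (H.partV spl j x) (H.constit (j + 1) x) else []

/-- **THE DISSOLVED BOOKKEEPING** (R-OWNER-22-7 (α) at the junction): fresh clusters removed from their level and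
replaced by their regions as single-birth pseudo-components; continued fresh clusters spliced into their regions one
level up; new regions, classes, level `0` lists unchanged. [folklore] -/
def dissolve (spl : ℕ → γ → γ → List γ) : ComponentHistory γ where
  comp j := ((H.comp j).filter fun c => ¬ H.Fresh j c) ∪ H.pseudo j
  newReg := H.newReg
  cls := H.cls
  constit := H.constitV spl
  fieldIn := H.fieldIn

variable (spl : ℕ → γ → γ → List γ)

/-- membership in the dissolved components [folklore] -/
theorem mem_comp_dissolve_iff {j : ℕ} {x : γ} :
    x ∈ (H.dissolve spl).comp j ↔ (x ∈ H.comp j ∧ ¬ H.Fresh j x) ∨ x ∈ H.pseudo j := by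
  simp only [dissolve, Finset.mem_union, Finset.mem_filter]

/-- a real non-fresh component is a dissolved component [folklore] -/
theorem mem_comp_dissolve_of_real {j : ℕ} {x : γ} (hx : x ∈ H.comp j) (hf : ¬ H.Fresh j x) :
    x ∈ (H.dissolve spl).comp j :=
  (H.mem_comp_dissolve_iff spl).2 (Or.inl ⟨hx, hf⟩)

/-- a pseudo-component is a dissolved component [folklore] -/
theorem mem_comp_dissolve_of_pseudo {j : ℕ} {x : γ} (hx : x ∈ H.pseudo j) : x ∈ (H.dissolve spl).comp j :=
  (H.mem_comp_dissolve_iff spl).2 (Or.inr hx)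

/-- new regions are unchanged [folklore] -/
@[simp] theorem newReg_dissolve : (H.dissolve spl).newReg = H.newReg := rfl

/-- classes are unchanged [folklore] -/
@[simp] theorem cls_dissolve : (H.dissolve spl).cls = H.cls := rfl

/-- the constituents of a pseudo-component [folklore] -/
theorem constit_dissolve_pseudo {j : ℕ} {n : γ} (hn : n ∈ H.pseudo j) : (H.dissolve spl).constit j n = [Sum.inr n] := by
  classical
  cases j with
  | zero => show H.constitV spl 0 n = _; simp [constitV, hn]
  | succ j => show H.constitV spl (j + 1) n = _; simp [constitV, hn]

/-- the constituents of a real non-fresh component of level `0` [folklore] -/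
theorem constit_dissolve_zero {c : γ} (hc : c ∈ H.comp 0) (hf : ¬ H.Fresh 0 c) (hp : c ∉ H.pseudo 0) :
    (H.dissolve spl).constit 0 c = H.constit 0 c := by
  classical
  show H.constitV spl 0 c = _; simp [constitV, hp, hc, hf]

/-- the constituents of a real non-fresh component of a successor level: the splice [folklore] -/
theorem constit_dissolve_succ {j : ℕ} {c : γ} (hc : c ∈ H.comp (j + 1)) (hf : ¬ H.Fresh (j + 1) c)
    (hp : c ∉ H.pseudo (j + 1)) : (H.dissolve spl).constit (j + 1) c = splice (H.partV spl j c) (H.constit (j + 1) c) := by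
  classical
  show H.constitV spl (j + 1) c = _; simp [constitV, hp, hc, hf]

/-- no constituents off the dissolved components [folklore] -/
theorem constit_dissolve_of_not_mem {j : ℕ} {x : γ} (hx : x ∉ (H.dissolve spl).comp j) : (H.dissolve spl).constit j x = [] := by
  classical
  rw [mem_comp_dissolve_iff, not_or] at hx
  cases j with
  | zero => show H.constitV spl 0 x = _; simp [constitV, hx.2, hx.1]
  | succ j => show H.constitV spl (j + 1) x = _; simp [constitV, hx.2, hx.1]

/-! ### parts and news of the dissolved bookkeeping -/

/-- a pseudo-component has no old part [folklore] -/
theorem parts_dissolve_pseudo {j : ℕ} {n : γ} (hn : n ∈ H.pseudo j) : (H.dissolve spl).parts j n = [] := by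
  rw [parts, H.constit_dissolve_pseudo spl hn]; rfl

/-- a pseudo-component's news is its region [folklore] -/
theorem news_dissolve_pseudo {j : ℕ} {n : γ} (hn : n ∈ H.pseudo j) : (H.dissolve spl).news j n = [n] := by
  rw [news, H.constit_dissolve_pseudo spl hn]; rfl

/-- the parts of a real non-fresh component of level `0` are unchanged [folklore] -/
theorem parts_dissolve_zero {c : γ} (hc : c ∈ H.comp 0) (hf : ¬ H.Fresh 0 c) (hp : c ∉ H.pseudo 0) :
    (H.dissolve spl).parts 0 c = H.parts 0 c := by
  rw [parts, H.constit_dissolve_zero spl hc hf hp]; rfl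

/-- **THE PARTS OF A REAL NON-FRESH COMPONENT OF A SUCCESSOR LEVEL**: each old part replaced, in order. [folklore] -/
theorem parts_dissolve_succ {j : ℕ} {c : γ} (hc : c ∈ H.comp (j + 1)) (hf : ¬ H.Fresh (j + 1) c)
    (hp : c ∉ H.pseudo (j + 1)) : (H.dissolve spl).parts (j + 1) c = (H.parts (j + 1) c).flatMap (H.partV spl j c) := by
  rw [parts, H.constit_dissolve_succ spl hc hf hp, lefts_splice]; rfl

/-- the news of a real non-fresh component are unchanged [folklore] -/
theorem news_dissolve_real {j : ℕ} {c : γ} (hc : c ∈ H.comp j) (hf : ¬ H.Fresh j c) (hp : c ∉ H.pseudo j) :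
    (H.dissolve spl).news j c = H.news j c := by
  cases j with
  | zero => rw [news, H.constit_dissolve_zero spl hc hf hp]; rfl
  | succ j => rw [news, H.constit_dissolve_succ spl hc hf hp, rights_splice]; rfl

/-- membership in the parts of a real non-fresh component of a successor level [folklore] -/
theorem mem_parts_dissolve_succ_iff {j : ℕ} {c : γ} (hc : c ∈ H.comp (j + 1)) (hf : ¬ H.Fresh (j + 1) c)
    (hp : c ∉ H.pseudo (j + 1)) {q : γ} :
    q ∈ (H.dissolve spl).parts (j + 1) c ↔
      (q ∈ H.parts (j + 1) c ∧ ¬ H.Fresh j q) ∨ ∃ p ∈ H.parts (j + 1) c, H.Fresh j p ∧ q ∈ spl j c p := by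
  rw [H.parts_dissolve_succ spl hc hf hp, List.mem_flatMap]
  constructor
  · rintro ⟨p, hp', hq⟩
    by_cases hfp : H.Fresh j p
    · rw [H.partV_of_fresh spl c hfp] at hq; exact Or.inr ⟨p, hp', hfp, hq⟩
    · rw [H.partV_of_not_fresh spl c hfp, List.mem_singleton] at hq; subst hq; exact Or.inl ⟨hp', hfp⟩
  · rintro (⟨hq, hfq⟩ | ⟨p, hp', hfp, hq⟩)
    · exact ⟨q, hq, by rw [H.partV_of_not_fresh spl c hfq]; exact List.mem_singleton_self _⟩
    · exact ⟨p, hp', by rw [H.partV_of_fresh spl c hfp]; exact hq⟩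

end

end ComponentHistory

end Summit.QuantumFields.BalabanUV.T4Continuum.HistoryGenealogyExtraction
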